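import Summits.CriticalPhenomena.PercolationContinuityZ3.Theorems.PercNearOneGluingNoHeavyLowerTailCILRelayGluing
import HarnessLib

/-!
# `NoHeavyLowerTail` (stmt-CriticalPhenomena-4575) — the cumulative isolation lemma for observers with relay
# neighbours and ONE Steiner neighbour (the CIL analogue of Kozma–Nitzan's Theorem 5)

Seat `prim-gen-swap` (gen 1), 2026-08-18.  Notation as in `…CILRelayGluing.lean`.

* `cil_oneSteiner_of` — the MODULAR step: CIL for `x` in `G − o` (champion witnesses) ⇒ CIL for `o` in `G`, when
  the positive-weight neighbours of `o` are relays and possibly the one vertex `x`;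
* `cil_oneSteiner`, `cil_oneSteiner_exists` — if the positive-weight neighbours of the observer `o ∉ A` are relays and
  possibly ONE further vertex `x ∉ A` all of whose other positive-weight neighbours are relays, then
  `μ(1 ≤ |π(o)| ≤ j) ≤ μ(|π(c)| ≤ j)` for every champion `c` of `w`, at every level `j` (hence the registered
  `stub_cumulativeIsolation` for such observers).  Relay pairs at `o` are peeled first (merge stability at relays,
  `CILOneSteiner.mergeStability_at_relay`); when only `s(o,x)` is left, `o` is almost surely a pendant vertex of `x` in the
  deleted law, `L_o` under the glued law is bounded by `L_x` under the deleted law, and `x` has relay neighbours only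
  (`CILOneSteiner.cil_champion_of_relayNeighbours`).  CIL analogue of [KozmaNitzan2024, Thm 5] ("0 connected only to
  `A` and to a certain `x`, which is connected only to `A ∪ 0`"); the case of TWO Steiner neighbours is the open
  champion-robustness step CS(H,{x,y}) (report MAX-TRANSFER.md §SYNTHESIS on the item).
-/

noncomputable section

namespace Summit.CriticalPhenomena.PercolationContinuityZ3.Theorems

open MeasureTheory Set Literature.Probability.LatticeModels Literature.Probability.Percolation
open scoped Classical BigOperators

variable {n : ℕ}

open CILOneSteiner ChampionStability MergeStability RelayNbhd

/-- **Modular one-Steiner step** (the CIL analogue of [KozmaNitzan2024, Thm 5]): if the positive-weight neighbours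
of `o` are relays and possibly one further vertex `x ∉ A`, and in the graph `G − o` (pairs at `o` closed,
`pinW w {e | o ∈ e ∧ ¬ e.IsDiag} ∅`) CIL holds for the observer `x` with every champion of `G − o` as witness, then
CIL holds for `o` in `G` with every champion of `G` as witness, at the same level.  Iterating along a path of such
vertices gives CIL for observers at the end of a Steiner path with relay hairs. -/
theorem cil_oneSteiner_of (A : Finset (Fin n)) (o x : Fin n) (j : ℕ) (ho : o ∉ A) (hx : x ∉ A) (hxo : x ≠ o) :
    ∀ (m : ℕ) (w : Sym2 (Fin n) → unitInterval),
      (A.filter fun v => 0 < (w s(o, v) : ℝ)).card = m →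
      (∀ v : Fin n, v ≠ o → v ∉ A → v ≠ x → (w s(o, v) : ℝ) = 0) →
      (∀ c' ∈ A, (∀ a ∈ A,
        (prodBernoulli (pinW w {e : Sym2 (Fin n) | o ∈ e ∧ ¬ e.IsDiag} ∅)).real
            {ω : BondConfig (Fin n) | (A.filter fun z => ω ∈ openConn a z).card ≤ j} ≤
          (prodBernoulli (pinW w {e : Sym2 (Fin n) | o ∈ e ∧ ¬ e.IsDiag} ∅)).real
            {ω : BondConfig (Fin n) | (A.filter fun z => ω ∈ openConn c' z).card ≤ j}) →
        (prodBernoulli (pinW w {e : Sym2 (Fin n) | o ∈ e ∧ ¬ e.IsDiag} ∅)).real {ω : BondConfig (Fin n) |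
            1 ≤ (A.filter fun z => ω ∈ openConn x z).card ∧ (A.filter fun z => ω ∈ openConn x z).card ≤ j} ≤
          (prodBernoulli (pinW w {e : Sym2 (Fin n) | o ∈ e ∧ ¬ e.IsDiag} ∅)).real
            {ω : BondConfig (Fin n) | (A.filter fun z => ω ∈ openConn c' z).card ≤ j}) →
      ∀ c ∈ A, (∀ a ∈ A,
        (prodBernoulli w).real {ω : BondConfig (Fin n) | (A.filter fun z => ω ∈ openConn a z).card ≤ j} ≤
          (prodBernoulli w).real {ω : BondConfig (Fin n) | (A.filter fun z => ω ∈ openConn c z).card ≤ j}) →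
      (prodBernoulli w).real {ω : BondConfig (Fin n) |
          1 ≤ (A.filter fun z => ω ∈ openConn o z).card ∧ (A.filter fun z => ω ∈ openConn o z).card ≤ j} ≤
        (prodBernoulli w).real {ω : BondConfig (Fin n) | (A.filter fun z => ω ∈ openConn c z).card ≤ j} := by
  intro m
  induction m with
  | zero =>
    intro w hm hoN hH c hc hchampw
    -- no relay pair at `o`: only `s(o,x)` may be positive
    have hrel0 : ∀ v ∈ A, (w s(o, v) : ℝ) = 0 := by
      intro v hv
      by_contra hne
      have hpos : 0 < (w s(o, v) : ℝ) := lt_of_le_of_ne (w s(o, v)).2.1 (Ne.symm hne)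
      have hmem : v ∈ (A.filter fun v => 0 < (w s(o, v) : ℝ)) := Finset.mem_filter.2 ⟨hv, hpos⟩
      rw [Finset.card_eq_zero] at hm
      rw [hm] at hmem
      exact Finset.notMem_empty v hmem
    set e : Sym2 (Fin n) := s(o, x) with he
    set w₀ : Sym2 (Fin n) → unitInterval := Function.update w e 0 with hw₀
    set w₁ : Sym2 (Fin n) → unitInterval := Function.update w e 1 with hw₁
    set μ₀ := prodBernoulli w₀ with hμ₀
    -- under `w₀`, `o` is isolated
    have hiso₀ : ∀ v : Fin n, v ≠ o → (w₀ s(o, v) : ℝ) = 0 := by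
      intro v hv
      by_cases hvx : v = x
      · subst hvx; simp [hw₀, he]
      · by_cases hvA : v ∈ A
        · exact update_zero_apply_eq_zero w e _ (hrel0 v hvA)
        · exact update_zero_apply_eq_zero w e _ (hoN v hv hvA hvx)
    -- `w₀` IS the graph `G − o`
    have hw₀pin : w₀ = pinW w {e : Sym2 (Fin n) | o ∈ e ∧ ¬ e.IsDiag} ∅ := by
      funext e'
      by_cases hmem : e' ∈ {e : Sym2 (Fin n) | o ∈ e ∧ ¬ e.IsDiag}
      · obtain ⟨hoe, hdiag⟩ := hmem
        obtain ⟨v, rfl⟩ : ∃ v, e' = s(o, v) := by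
          induction e' using Sym2.ind with
          | h a b =>
            rcases Sym2.mem_iff.1 hoe with rfl | rfl
            · exact ⟨b, rfl⟩
            · exact ⟨a, Sym2.eq_swap⟩
        have hvo : v ≠ o := by
          intro h; apply hdiag; rw [h]; exact Sym2.mk_isDiag_iff.2 rfl
        rw [pinW_star_mk w hvo]
        exact Subtype.ext (hiso₀ v hvo)
      · rw [pinW_apply_of_not_mem w ∅ hmem]
        have hne : e' ≠ e := by
          rw [he]; intro h; apply hmem; rw [h]
          exact ⟨Sym2.mem_mk_left o x, by rw [Sym2.mk_isDiag_iff]; exact hxo.symm⟩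
        rw [hw₀, Function.update_of_ne hne]
    -- a champion `c₀` of `w₀`; CIL for the observer `x` under `w₀` (hypothesis)
    obtain ⟨c₀, hc₀, hchamp₀⟩ := exists_champion μ₀ A ⟨c, hc⟩ j
    have hLx : μ₀.real {ω : BondConfig (Fin n) |
        1 ≤ (A.filter fun z => ω ∈ openConn x z).card ∧ (A.filter fun z => ω ∈ openConn x z).card ≤ j} ≤
        μ₀.real {ω : BondConfig (Fin n) | (A.filter fun z => ω ∈ openConn c₀ z).card ≤ j} := by
      have H := hH c₀ hc₀
      rw [← hw₀pin] at H
      exact H hchamp₀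
    -- the `o`-isolation event has full `μ₀`-measure
    set F := (Finset.univ.filter fun v : Fin n => v ≠ o).image (fun v => s(o, v)) with hF
    set Bad : Set (BondConfig (Fin n)) := {ω | ∃ e' ∈ F, e' ∈ ω} with hBad
    have hBad0 : μ₀.real Bad = 0 := by
      have hzero : μ₀ Bad = 0 := by
        refine prodBernoulli_setOf_exists_mem_eq_zero w₀ F fun e' he' => ?_
        obtain ⟨v, hv, rfl⟩ := Finset.mem_image.1 he'
        exact hiso₀ v (Finset.mem_filter.1 hv).2
      rw [measureReal_def, hzero, ENNReal.toReal_zero]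
    have hisoω : ∀ ω : BondConfig (Fin n), ω ∉ Bad → ∀ v : Fin n, v ≠ o → s(o, v) ∉ ω := by
      intro ω hω v hv hmem
      exact hω ⟨s(o, v), Finset.mem_image.2 ⟨v, Finset.mem_filter.2 ⟨Finset.mem_univ _, hv⟩, rfl⟩, hmem⟩
    have hmeas : ∀ S : Set (BondConfig (Fin n)), MeasurableSet S := fun S => (Set.toFinite S).measurableSet
    -- (d) `μ₁(L_o) ≤ μ₀(L_x)`
    have hw₀e : w₀ s(o, x) = 0 := by simp [hw₀, he]
    have hw₁eq : Function.update w₀ s(o, x) 1 = w₁ := by rw [hw₀, hw₁, he, Function.update_idem]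
    have hLo : (prodBernoulli w₁).real {ω : BondConfig (Fin n) |
        1 ≤ (A.filter fun z => ω ∈ openConn o z).card ∧ (A.filter fun z => ω ∈ openConn o z).card ≤ j} ≤
        μ₀.real {ω : BondConfig (Fin n) |
          1 ≤ (A.filter fun z => ω ∈ openConn x z).card ∧ (A.filter fun z => ω ∈ openConn x z).card ≤ j} := by
      rw [← hw₁eq, real_update_one_eq w₀ hw₀e]
      have hsub : ((fun ω : BondConfig (Fin n) => insert s(o, x) ω) ⁻¹' {ω : BondConfig (Fin n) |
          1 ≤ (A.filter fun z => ω ∈ openConn o z).card ∧ (A.filter fun z => ω ∈ openConn o z).card ≤ j}) ⊆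
          {ω : BondConfig (Fin n) | 1 ≤ (A.filter fun z => ω ∈ openConn x z).card ∧
            (A.filter fun z => ω ∈ openConn x z).card ≤ j} ∪ Bad := by
        intro ω hω
        by_cases hB : ω ∈ Bad
        · exact Or.inr hB
        · left
          simp only [mem_preimage, mem_setOf_eq] at hω ⊢
          have hfilt : (A.filter fun z => insert s(o, x) ω ∈ openConn o z) =
              (A.filter fun z => ω ∈ openConn x z) := by
            refine Finset.filter_congr fun z hz => ?_
            show (openGraph (insert s(o, x) ω)).Reachable o z ↔ (openGraph ω).Reachable x z
            rw [reachable_insert_left_iff ω (Ne.symm hxo) z]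
            constructor
            · rintro (h | h)
              · exact absurd (eq_of_reachable_of_isolated (hisoω ω hB) h) (fun hzo => ho (hzo ▸ hz))
              · exact h
            · exact fun h => Or.inr h
          rwa [hfilt] at hω
      calc μ₀.real _ ≤ μ₀.real ({ω : BondConfig (Fin n) | 1 ≤ (A.filter fun z => ω ∈ openConn x z).card ∧
              (A.filter fun z => ω ∈ openConn x z).card ≤ j} ∪ Bad) := measureReal_mono hsub
        _ ≤ μ₀.real {ω : BondConfig (Fin n) | 1 ≤ (A.filter fun z => ω ∈ openConn x z).card ∧
              (A.filter fun z => ω ∈ openConn x z).card ≤ j} + μ₀.real Bad := measureReal_union_le _ _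
        _ = _ := by rw [hBad0, add_zero]
    -- (f) `μ₀(R_{c₀}) ≤ μ₁(R_{c₀})`
    have hRc : μ₀.real {ω : BondConfig (Fin n) | (A.filter fun z => ω ∈ openConn c₀ z).card ≤ j} ≤
        (prodBernoulli w₁).real {ω : BondConfig (Fin n) | (A.filter fun z => ω ∈ openConn c₀ z).card ≤ j} := by
      rw [← hw₁eq, real_update_one_eq w₀ hw₀e]
      set R : Set (BondConfig (Fin n)) := {ω | (A.filter fun z => ω ∈ openConn c₀ z).card ≤ j} with hR
      have hsub : R \ Bad ⊆ (fun ω : BondConfig (Fin n) => insert s(o, x) ω) ⁻¹' R := by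
        intro ω hω
        obtain ⟨hωR, hB⟩ := hω
        simp only [hR, mem_preimage, mem_setOf_eq] at hωR ⊢
        have hco : ¬ (openGraph ω).Reachable c₀ o := fun h =>
          ho ((eq_of_reachable_of_isolated (hisoω ω hB) h.symm) ▸ hc₀)
        have hfilt : (A.filter fun z => insert s(o, x) ω ∈ openConn c₀ z) =
            (A.filter fun z => ω ∈ openConn c₀ z) := by
          refine Finset.filter_congr fun z hz => ?_
          show (openGraph (insert s(o, x) ω)).Reachable c₀ z ↔ (openGraph ω).Reachable c₀ z
          rw [reachable_insert_iff ω (Ne.symm hxo)]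
          constructor
          · rintro (h | ⟨⟨s, hs, hcs⟩, ⟨t, ht, htz⟩⟩)
            · exact h
            · simp only [Finset.mem_insert, Finset.mem_singleton] at hs ht
              rcases hs with rfl | rfl
              · exact absurd hcs hco
              · rcases ht with rfl | rfl
                · exact absurd (eq_of_reachable_of_isolated (hisoω ω hB) htz) (fun hzo => ho (hzo ▸ hz))
                · exact hcs.trans htz
          · exact fun h => Or.inl h
        rw [hfilt]
        exact hωR
      have hsplit : μ₀.real (R ∩ Bad) + μ₀.real (R \ Bad) = μ₀.real R :=
        measureReal_inter_add_sdiff (hmeas Bad) (measure_ne_top _ _)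
      have hRB : μ₀.real (R ∩ Bad) = 0 :=
        le_antisymm ((measureReal_mono inter_subset_right).trans hBad0.le) measureReal_nonneg
      calc μ₀.real R = μ₀.real (R \ Bad) := by linarith
        _ ≤ _ := measureReal_mono hsub
    -- (b) `μ₀(L_o) = 0` and (g) assembly through the one-bond decomposition
    have hL0 := real_L_eq_zero_of_isolated w₀ A o j ho hiso₀
    have hRcc : (prodBernoulli w).real {ω : BondConfig (Fin n) | (A.filter fun z => ω ∈ openConn c₀ z).card ≤ j} ≤
        (prodBernoulli w).real {ω : BondConfig (Fin n) | (A.filter fun z => ω ∈ openConn c z).card ≤ j} :=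
      hchampw c₀ hc₀
    refine le_trans ?_ hRcc
    have hp0 : 0 ≤ (w e : ℝ) := (w e).2.1
    have hp1 : (w e : ℝ) ≤ 1 := (w e).2.2
    rw [stub_oneBondDecomp_k15 n w e {ω : BondConfig (Fin n) |
        1 ≤ (A.filter fun z => ω ∈ openConn o z).card ∧ (A.filter fun z => ω ∈ openConn o z).card ≤ j},
      stub_oneBondDecomp_k15 n w e {ω : BondConfig (Fin n) |
        (A.filter fun z => ω ∈ openConn c₀ z).card ≤ j}]
    rw [← hw₀, ← hw₁, ← hμ₀] at *
    rw [hL0, mul_zero, zero_add]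
    have h1 : (w e : ℝ) * (prodBernoulli w₁).real {ω : BondConfig (Fin n) |
          1 ≤ (A.filter fun z => ω ∈ openConn o z).card ∧ (A.filter fun z => ω ∈ openConn o z).card ≤ j} ≤
        (w e : ℝ) * (prodBernoulli w₁).real {ω : BondConfig (Fin n) |
          (A.filter fun z => ω ∈ openConn c₀ z).card ≤ j} :=
      mul_le_mul_of_nonneg_left (hLo.trans (hLx.trans hRc)) hp0
    have h0 : 0 ≤ (1 - (w e : ℝ)) * μ₀.real {ω : BondConfig (Fin n) |
          (A.filter fun z => ω ∈ openConn c₀ z).card ≤ j} :=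
      mul_nonneg (by linarith) measureReal_nonneg
    linarith
  | succ m ih =>
    intro w hm hoN hH c hc hchampw
    obtain ⟨v, hv⟩ := Finset.card_pos.1 (by omega : 0 < (A.filter fun v => 0 < (w s(o, v) : ℝ)).card)
    obtain ⟨hvA, hvpos⟩ := Finset.mem_filter.1 hv
    have hvo : v ≠ o := fun h => ho (h ▸ hvA)
    have hvx : v ≠ x := fun h => hx (h ▸ hvA)
    set e : Sym2 (Fin n) := s(o, v) with he
    set w₀ : Sym2 (Fin n) → unitInterval := Function.update w e 0 with hw₀
    set w₁ : Sym2 (Fin n) → unitInterval := Function.update w e 1 with hw₁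
    have hcount : (A.filter fun u => 0 < (w₀ s(o, u) : ℝ)).card = m := by
      have hset : (A.filter fun u => 0 < (w₀ s(o, u) : ℝ)) = (A.filter fun u => 0 < (w s(o, u) : ℝ)).erase v := by
        ext u
        simp only [Finset.mem_filter, Finset.mem_erase]
        by_cases huv : u = v
        · subst huv
          simp [hw₀, he, hvA]
        · have hne : s(o, u) ≠ e := by
            rw [he]
            intro h
            exact huv (Sym2.congr_right.1 h)
          simp [hw₀, Function.update_of_ne hne, huv]
      rw [hset, Finset.card_erase_of_mem hv, hm]
      rfl
    have hoN₀ : ∀ u : Fin n, u ≠ o → u ∉ A → u ≠ x → (w₀ s(o, u) : ℝ) = 0 :=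
      fun u hu huA hux => update_zero_apply_eq_zero w e _ (hoN u hu huA hux)
    have hH₀ := hH
    rw [← pinW_star_update w hvo (0 : unitInterval)] at hH₀
    obtain ⟨c₀, hc₀, hchamp₀⟩ := exists_champion (prodBernoulli w₀) A ⟨c, hc⟩ j
    have hL₀ := ih w₀ hcount hoN₀ hH₀ c₀ hc₀ hchamp₀
    have hw₀e : w₀ s(o, v) = 0 := by simp [hw₀, he]
    have hMS := mergeStability_at_relay w₀ A o v c₀ j ho hvA hc₀ hw₀e hchamp₀
    have hw₁eq : Function.update w₀ s(o, v) 1 = w₁ := by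
      rw [hw₀, hw₁, he, Function.update_idem]
    rw [hw₁eq] at hMS
    have hp0 : 0 ≤ (w e : ℝ) := (w e).2.1
    have hp1 : (w e : ℝ) ≤ 1 := (w e).2.2
    have hRc : (prodBernoulli w).real {ω : BondConfig (Fin n) | (A.filter fun z => ω ∈ openConn c₀ z).card ≤ j} ≤
        (prodBernoulli w).real {ω : BondConfig (Fin n) | (A.filter fun z => ω ∈ openConn c z).card ≤ j} :=
      hchampw c₀ hc₀
    refine le_trans ?_ hRc
    rw [stub_oneBondDecomp_k15 n w e {ω : BondConfig (Fin n) |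
        1 ≤ (A.filter fun z => ω ∈ openConn o z).card ∧ (A.filter fun z => ω ∈ openConn o z).card ≤ j},
      stub_oneBondDecomp_k15 n w e {ω : BondConfig (Fin n) |
        (A.filter fun z => ω ∈ openConn c₀ z).card ≤ j}]
    have h0 : (1 - (w e : ℝ)) * (prodBernoulli w₀).real {ω : BondConfig (Fin n) |
          1 ≤ (A.filter fun z => ω ∈ openConn o z).card ∧ (A.filter fun z => ω ∈ openConn o z).card ≤ j} ≤
        (1 - (w e : ℝ)) * (prodBernoulli w₀).real {ω : BondConfig (Fin n) |
          (A.filter fun z => ω ∈ openConn c₀ z).card ≤ j} :=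
      mul_le_mul_of_nonneg_left hL₀ (by linarith)
    have h1 : (w e : ℝ) * (prodBernoulli w₁).real {ω : BondConfig (Fin n) |
          1 ≤ (A.filter fun z => ω ∈ openConn o z).card ∧ (A.filter fun z => ω ∈ openConn o z).card ≤ j} ≤
        (w e : ℝ) * (prodBernoulli w₁).real {ω : BondConfig (Fin n) |
          (A.filter fun z => ω ∈ openConn c₀ z).card ≤ j} :=
      mul_le_mul_of_nonneg_left hMS hp0
    exact add_le_add h0 h1

/-- **CIL (all levels, champion witness) for an observer with relay neighbours and ONE Steiner neighbour `x` whose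
other positive-weight neighbours are relays** — `cil_oneSteiner_of` with the hypothesis discharged by
`CILOneSteiner.cil_champion_of_relayNeighbours` in `G − o`. -/
theorem cil_oneSteiner (w : Sym2 (Fin n) → unitInterval) (A : Finset (Fin n)) (o x : Fin n) (j : ℕ)
    (ho : o ∉ A) (hx : x ∉ A) (hxo : x ≠ o)
    (hoN : ∀ v : Fin n, v ≠ o → v ∉ A → v ≠ x → (w s(o, v) : ℝ) = 0)
    (hxN : ∀ u : Fin n, u ≠ x → u ∉ A → u ≠ o → (w s(x, u) : ℝ) = 0)
    (c : Fin n) (hc : c ∈ A)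
    (hchamp : ∀ a ∈ A,
      (prodBernoulli w).real {ω : BondConfig (Fin n) | (A.filter fun z => ω ∈ openConn a z).card ≤ j} ≤
        (prodBernoulli w).real {ω : BondConfig (Fin n) | (A.filter fun z => ω ∈ openConn c z).card ≤ j}) :
    (prodBernoulli w).real {ω : BondConfig (Fin n) |
        1 ≤ (A.filter fun z => ω ∈ openConn o z).card ∧ (A.filter fun z => ω ∈ openConn o z).card ≤ j} ≤
      (prodBernoulli w).real {ω : BondConfig (Fin n) | (A.filter fun z => ω ∈ openConn c z).card ≤ j} := by
  refine cil_oneSteiner_of A o x j ho hx hxo _ w rfl hoN ?_ c hc hchamp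
  intro c' hc' hchamp'
  refine cil_champion_of_relayNeighbours A x j hx _ _ rfl ?_ c' hc' hchamp'
  intro u hu huA
  by_cases huo : u = o
  · subst huo
    rw [Sym2.eq_swap, pinW_star_mk w hxo]
    rfl
  · have hmem : s(x, u) ∉ {e : Sym2 (Fin n) | o ∈ e ∧ ¬ e.IsDiag} := by
      rintro ⟨hoe, -⟩
      rcases Sym2.mem_iff.1 hoe with h | h
      · exact hxo h.symm
      · exact huo h.symm
    rw [pinW_apply_of_not_mem w ∅ hmem]
    exact hxN u hu huA huo

/-- **One-Steiner CIL in the shape of the registered `stub_cumulativeIsolation`** (restricted hypotheses): for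
`A` nonempty, `o ∉ A`, and a vertex `x ∉ A`, `x ≠ o`, such that every other positive-weight neighbour of `o` and of
`x` is a relay, `∃ a ∈ A, μ(1 ≤ N ≤ j) ≤ μ(|π(a)| ≤ j)` at every level `j`. -/
theorem cil_oneSteiner_exists (w : Sym2 (Fin n) → unitInterval) (A : Finset (Fin n)) (o x : Fin n) (j : ℕ)
    (hA : A.Nonempty) (ho : o ∉ A) (hx : x ∉ A) (hxo : x ≠ o)
    (hoN : ∀ v : Fin n, v ≠ o → v ∉ A → v ≠ x → (w s(o, v) : ℝ) = 0)
    (hxN : ∀ u : Fin n, u ≠ x → u ∉ A → u ≠ o → (w s(x, u) : ℝ) = 0) :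
    ∃ a ∈ A, (prodBernoulli w).real {ω : BondConfig (Fin n) |
        1 ≤ (A.filter fun z => ω ∈ openConn o z).card ∧ (A.filter fun z => ω ∈ openConn o z).card ≤ j} ≤
      (prodBernoulli w).real {ω : BondConfig (Fin n) | (A.filter fun z => ω ∈ openConn a z).card ≤ j} := by
  obtain ⟨c, hc, hchamp⟩ := exists_champion (prodBernoulli w) A hA j
  exact ⟨c, hc, cil_oneSteiner w A o x j ho hx hxo hoN hxN c hc hchamp⟩

end Summit.CriticalPhenomena.PercolationContinuityZ3.Theorems

end
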